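import Summits.ABC.IUTFork.Joshi.TestIsmScalingResults
import Summits.ABC.IUTFork.Joshi.TestPinsLabelZero
import HarnessLib

/-!
# Block E, test X-07′ — the «Joshi-style (Ind2)» instantiation, III: the dictionary's seven candidate Props, non-degenerately; the label-0 pins artefact

Record file (D-0012; one model-data definition `scalDictionary`, no `Prop` fact) of the abc-iut cell, block E (rung LADDER-ABC:A2.E; seat
abc-iut-E-t41, slot T-41 = test row X-07′; plan/E/cx/TEST-LEDGER.md row «X-01 model slot»: the DEGENERATE floor is abc-iut-E-t42's
`Joshi.dictionary_floor_model` (TestDictionaryFloor p429619: `Move := PEmpty`, `base = std`, datum `≡ Ψ_n`, (Ind)-trivial); «the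
non-degenerate model is X-07′» (E-cx)). TAKES NO SIDE on [IUTchIII] Cor. 3.12, on Joshi's claims or on Mochizuki's report on them.

Over the Joshi-style instantiation of parts 0–II (`scalFull p`, `scalSetting p`, operator `scalRegion p`, q-datum `qDatum p`: the pinned
model of record with `LogShells.ism := univ`), abc-iut-E-plan's dictionary datum `Joshi.Dictionary` (Dictionary.lean p428775) is
instantiated CONTENTFULLY: points `Pt := ℕ` = the untilt orbit `k ↦ (untilt change)^k · Ψ_v` of the line's Θ-pilot splitting monoid
(K. Joshi, arXiv:2401.13508v4: Thm. 4.2.2.1 (1)–(4) p. 33, the Ansatz is stable under the change of untilt; §6.10.1 «Ξ_z as Θ-pilot objects»;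
the valuation-rescaling move itself = his (Ind2) §8.11.1 p. 91 l. 44–46, E-lit EL-040, with second print home Prop. 10.3.3 (2) p. 132 =
abc-iut-E-t34's `Summit.ABC.IUTFork.Joshi.ATS3.Frob.Prop1033_2`, FrobenioidsJoshi p431166),
one move `Move := Unit` acting by `k ↦ k+1` and realised by the (Ind2)-family `untiltFamily` (`p^{1−j²}` on the factor `0`), `base := 0`
(the Θ-pilot datum `Ψ_v` itself), standard point `std := 1` (one untilt change: the q-datum `{(±q)_j}`, `starAut_untiltFamily_image_Psi`).
ALL SEVEN candidate Props HOLD (`scalDictionary_props`): `BaseIsThetaPilot`, `MovesAreInd`, `DatumEquivariant`, `StdReachable` (hence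
`AnsatzWithinInd`, by the dictionary's own glue `ansatzWithinInd_of_moves`), `StandardPointIsQPilot`, `StandardPointHasQPilotVolume` — with
`Move` inhabited, `base ≠ std` and `¬ LogvolInvariant` (nothing vacuous, nothing (Ind)-trivial) — while, by part II, the typed Statement of
Cor. 3.12 and `BridgeHyps` FAIL there (`finite`). So the hypothesis set of X-01 (`Joshi.pilotKummerIndRelated_of_ansatzWithinInd`) is
satisfiable NON-degenerately exactly where the typed `−|log(Θ)|` is `+∞`; at the model of record (volume-preserving (Ind2)) it is refuted
(abc-iut-E-cx `pinnedSetting_not_ansatzWithinInd_of_stdIsQPilot`, p429682). Located, not adjudicated; interface level over `toyIndex`;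
typed ≠ proved ≠ endorsed.

§2 — THE PINS REPORT, SECOND READING (abc-iut-E-cx 2026-08-26T08:00:11Z, `Joshi.not_thetaPinned_of_moves_zero`, TestPinsLabelZero): the
landed model carries the FORCED zero-label convention (ρ₀ = Θ-glue₀ = q-glue₀ := univ, frame₀ := `univFrame`), under which all four pins
hold (part II). With ANY ball-valued label-0 region instead — in particular with the VERBATIM operator of the model of record,
`PinnedWitness.orbitRegion` (ρ₀ = 𝒪 = B_0) — the typed (hρ) FAILS at label 0 (and only there) over the Joshi-style shells, for every
setting: the (Ind2)-generator «`p` on the one factor at label 0, identity at the labels ≥ 1» (`scaleFamily (zeroUnits p)`) is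
star-trivial yet moves every ball at label 0 (`not_thetaPinned_of_ball_zero`, `not_pinnedRegions_orbitRegion`). A located artefact of
OUR signature (`StarPacket = ∏_{j ∈ 𝔽_l^⋆}` omits label 0 while (Ind2) acts there), no content at stake: nothing typed reads label 0.
[claim: Joshi2024ATS3, status: disputed] [claim: Mochizuki2012, status: disputed]
-/

noncomputable section

open Set

namespace Summit.ABC.IUTFork.Joshi.IsmScaling

open Thm311 Cor312 Cor312.Checks Cor312.IdentifiedNonVacuity Cor312Vol Cor312Vol.NaiveWitness Cor312Vol.PinnedWitness
  Literature.IUT.LogThetaLattice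

variable (p : ℕ) [hp : Fact p.Prime]

/-! ## 1. The dictionary instance -/

/-- The `k`-FOLD UNTILT ORBIT of the splitting monoid: `(untiltFamily)^k · Ψ_v` at every bad place ([J-III] Thm. 4.2.2.1: the Ansatz is
stable under the change of untilt). [claim: Joshi2024ATS3, status: disputed] -/
def orbitDatum (k : ℕ) : ∀ v : toyIndex.V, v ∈ toyIndex.Vbad → Set (signShells.StarPacket v) :=
  fun v _ => scalShells.starAut (untiltFamily p ^ k) v '' Psi p v

/-- **The dictionary datum for the Joshi-style instantiation** (abc-iut-E-plan's `Joshi.Dictionary`, rows D-02/D-03/D-04): points the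
untilt orbit `ℕ`, one move (the untilt change) acting by successor and realised by `untiltFamily`, base point `0` (datum `Ψ_v`), standard
point `1` (datum the q-tuple set). MODEL DATA. [claim: Joshi2024ATS3, status: disputed] -/
def scalDictionary : Dictionary (scalFull p).toLatticeSituation where
  Pt := ℕ
  Move := Unit
  act := fun _ k => k + 1
  base := 0
  std := 1
  datum := fun k => orbitDatum p k
  real := fun _ => untiltFamily p

/-- The base datum (no untilt change) IS the splitting monoid `Ψ_v`. [folklore] -/
theorem orbitDatum_zero (v : toyIndex.V) (hv : v ∈ toyIndex.Vbad) : orbitDatum p 0 v hv = Psi p v := by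
  show scalShells.starAut (untiltFamily p ^ 0) v '' Psi p v = Psi p v
  rw [pow_zero]
  ext x
  exact ⟨fun ⟨y, hy, hyx⟩ => by subst hyx; exact hy, fun hx => ⟨x, hx, rfl⟩⟩

/-- One untilt change of `Ψ_v` IS the q-pilot's Kummer datum `{(±q)_j}` (part II `starAut_untiltFamily_image_Psi`). [folklore] -/
theorem orbitDatum_one : orbitDatum p 1 = qDatum p := by
  funext v hv
  show scalShells.starAut (untiltFamily p ^ 1) v '' Psi p v = qDatum p v hv
  rw [pow_one]
  exact starAut_untiltFamily_image_Psi p v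

/-- The orbit is EQUIVARIANT: one more untilt change transports the datum by `untiltFamily`. [folklore] -/
theorem orbitDatum_succ (k : ℕ) (v : toyIndex.V) (hv : v ∈ toyIndex.Vbad) :
    orbitDatum p (k + 1) v hv = scalShells.starAut (untiltFamily p) v '' orbitDatum p k v hv := by
  show scalShells.starAut (untiltFamily p ^ (k + 1)) v '' Psi p v =
    scalShells.starAut (untiltFamily p) v '' (scalShells.starAut (untiltFamily p ^ k) v '' Psi p v)
  ext x
  constructor
  · rintro ⟨f, hf, rfl⟩
    exact ⟨scalShells.starAut (untiltFamily p ^ k) v f, ⟨f, hf, rfl⟩, by rw [pow_succ']; rfl⟩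
  · rintro ⟨_, ⟨f, hf, rfl⟩, rfl⟩
    exact ⟨f, hf, by rw [pow_succ']; rfl⟩

/-! ### The seven candidate Props HOLD, non-degenerately -/

/-- **D-02/D-03 `BaseIsThetaPilot` HOLDS**: the base datum is the line's Θ-pilot splitting monoid `Ψ_v`. [claim: Joshi2024ATS3, status: disputed] -/
theorem scalDictionary_baseIsThetaPilot : BaseIsThetaPilot (scalDictionary p) (P := scalSetting p) :=
  funext fun v => funext fun hv => orbitDatum_zero p v hv

/-- **Fragment 5 `MovesAreInd` HOLDS**: the one move is realised by the (Ind2)-family `untiltFamily ∈ ⟨(Ind1) ∪ (Ind2)⟩` — TRUE here because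
Ism `= univ` contains the valuation-rescalings (at the model of record, Ism `= {±1}`, no family realises it: X-06). [claim: Joshi2024ATS3, status: disputed] -/
theorem scalDictionary_movesAreInd : MovesAreInd (scalDictionary p) := fun _ => scaleFamily_mem_closure _

/-- **`DatumEquivariant` HOLDS** (the orbit is an orbit). [claim: Joshi2024ATS3, status: disputed] -/
theorem scalDictionary_datumEquivariant : DatumEquivariant (scalDictionary p) := fun _ k v hv => orbitDatum_succ p k v hv

/-- **`StdReachable` HOLDS**: the standard point is ONE untilt change away from the base point. [claim: Joshi2024ATS3, status: disputed] -/
theorem scalDictionary_stdReachable : StdReachable (scalDictionary p) := ⟨[()], rfl⟩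

/-- **Y₁ `AnsatzWithinInd` HOLDS** (by the dictionary's own glue `ansatzWithinInd_of_moves`). [claim: Joshi2024ATS3, status: disputed] -/
theorem scalDictionary_ansatzWithinInd : AnsatzWithinInd (scalRegion p) (scalDictionary p) (P := scalSetting p) :=
  ansatzWithinInd_of_moves (scalRegion p) (scalDictionary p) (scalDictionary_baseIsThetaPilot p) (scalDictionary_movesAreInd p)
    (scalDictionary_datumEquivariant p) (scalDictionary_stdReachable p)

/-- The standard-point datum IS the q-pilot's Kummer datum (as data, before `ρ`). [folklore] -/
theorem scalDictionary_datum_std : (scalDictionary p).datum (scalDictionary p).std = qDatum p := orbitDatum_one p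

/-- **Y₂ `StandardPointIsQPilot` HOLDS** (region form; here even datum-wise). [claim: Joshi2024ATS3, status: disputed] -/
theorem scalDictionary_standardPointIsQPilot : StandardPointIsQPilot (scalRegion p) (qDatum p) (scalDictionary p) := fun j vQ => by
  rw [scalDictionary_datum_std]

/-- **Y₂ (size form) `StandardPointHasQPilotVolume` HOLDS** (with equality: the standard-point region IS the q-pilot image, (pq′)).
[claim: Joshi2024ATS3, status: disputed] -/
theorem scalDictionary_standardPointHasQPilotVolume :
    StandardPointHasQPilotVolume (scalRegion p) (scalDictionary p) (P := scalSetting p) := fun j vQ => by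
  rw [scalDictionary_datum_std, ← scalSetting_qPinned p j vQ]
  exact le_rfl

/-- NON-DEGENERACY: the move type is inhabited, the base and standard points differ, and so do their data (their `ρ`-regions at the label
`2` are `B_4 ≠ B_1`); and (part II) the indeterminacies change log-volumes. [folklore] -/
theorem scalDictionary_nondegenerate :
    Nonempty (scalDictionary p).Move ∧ (scalDictionary p).base ≠ (scalDictionary p).std ∧
      (scalDictionary p).datum (scalDictionary p).base ≠ (scalDictionary p).datum (scalDictionary p).std ∧
      ¬ ((scalFull p).D (scalSetting p).n).LogvolInvariant := by
  refine ⟨⟨()⟩, Nat.zero_ne_one, fun h => ?_, scalSetting_not_logvolInvariant p⟩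
  have h0 : (scalDictionary p).datum (scalDictionary p).base = fun v _ => Psi p v := scalDictionary_baseIsThetaPilot p
  rw [h0, scalDictionary_datum_std] at h
  have h2 : scalRegion p (fun v _ => Psi p v) 2 () = scalRegion p (qDatum p) 2 () := congrArg (fun Ψ => scalRegion p Ψ 2 ()) h
  rw [scalRegion_Psi, if_neg (by decide), scalRegion_qDatum p (by decide)] at h2
  have := pBall_injective p 2 () h2
  exact absurd this (by decide)

/-- **THE SEVEN CANDIDATE PROPS OF THE DICTIONARY HOLD AT THE JOSHI-STYLE INSTANTIATION, NON-DEGENERATELY** — the contentful model of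
the hypothesis set of X-01 (plan/E/README.md §5 «model p<id>»; the degenerate floor is abc-iut-E-t42's `dictionary_floor_model`), AT A
SETTING WHERE THE TYPED STATEMENT OF COR. 3.12 AND `BridgeHyps` FAIL (part II). [claim: Joshi2024ATS3, status: disputed] -/
theorem scalDictionary_props :
    BaseIsThetaPilot (scalDictionary p) (P := scalSetting p) ∧ MovesAreInd (scalDictionary p) ∧ DatumEquivariant (scalDictionary p) ∧
      StdReachable (scalDictionary p) ∧ AnsatzWithinInd (scalRegion p) (scalDictionary p) (P := scalSetting p) ∧
      StandardPointIsQPilot (scalRegion p) (qDatum p) (scalDictionary p) ∧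
      StandardPointHasQPilotVolume (scalRegion p) (scalDictionary p) (P := scalSetting p) ∧
      (Nonempty (scalDictionary p).Move ∧ (scalDictionary p).base ≠ (scalDictionary p).std ∧
        (scalDictionary p).datum (scalDictionary p).base ≠ (scalDictionary p).datum (scalDictionary p).std ∧
        ¬ ((scalFull p).D (scalSetting p).n).LogvolInvariant) ∧
      ¬ (scalSetting p).Statement ∧ ¬ BridgeHyps (scalSetting p) :=
  ⟨scalDictionary_baseIsThetaPilot p, scalDictionary_movesAreInd p, scalDictionary_datumEquivariant p, scalDictionary_stdReachable p,
    scalDictionary_ansatzWithinInd p, scalDictionary_standardPointIsQPilot p, scalDictionary_standardPointHasQPilotVolume p,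
    scalDictionary_nondegenerate p, (scalSetting_not_statement_not_bridgeHyps p).1, (scalSetting_not_statement_not_bridgeHyps p).2⟩

/-- **X-01 at the Joshi-style instantiation**: the X-01 glue (`Joshi.pilotKummerIndRelated_of_ansatzWithinInd`) FIRES here and
returns S (the dictionary route to the same S as part II's direct (Ind2)-family route and abc-iut-E-cx's transitive form in
`TestIsmScalingTransitive`), under the three pins and the typed Thm. 3.11 — whereas the BRIDGE from the dictionary's Y-pair to the
printed Statement (abc-iut-E-cx `statement_of_ansatzWithinInd`, which needs `BridgeHyps`) cannot fire: its conclusion is FALSE here.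
The dictionary Props + pins + typed Thm. 3.11 do not give the typed Statement. [claim: Joshi2024ATS3, status: disputed] -/
theorem scalDictionary_props_and_not_statement :
    (AnsatzWithinInd (scalRegion p) (scalDictionary p) (P := scalSetting p) ∧
      StandardPointIsQPilot (scalRegion p) (qDatum p) (scalDictionary p) ∧
      PilotKummerIndRelated (scalFull p).toLatticeSituation (scalSetting p) (scalRegion p) (qDatum p) ∧
      PinnedRegions3 (scalFull p).toLatticeSituation (scalSetting p) (scalRegion p) (qDatum p) ∧ (scalFull p).Statement) ∧
    ¬ (scalSetting p).Statement :=
  ⟨⟨scalDictionary_ansatzWithinInd p, scalDictionary_standardPointIsQPilot p,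
    pilotKummerIndRelated_of_ansatzWithinInd (scalRegion p) (qDatum p) (scalDictionary p) (scalDictionary_ansatzWithinInd p)
      (scalDictionary_standardPointIsQPilot p),
    scalSetting_pinnedRegions3 p, scalFull_statement p⟩, (scalSetting_not_statement_not_bridgeHyps p).1⟩

/-! ## 2. The label-0 artefact of the typed Θ-pin (second reading of the pins report) -/

/-- The units of the LABEL-0 GENERATOR: `p` at the component-free label `0`, `1` at the labels of `𝔽_l^⋆`. [folklore] -/
def zeroUnits : toyIndex.Label → ℚˣ := fun j => if j = 0 then ppowUnit p 1 else 1

/-- At the labels of `𝔽_l^⋆` the generator `scaleFamily (zeroUnits p)` IS the identity (on the nose). [folklore] -/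
theorem scaleFamily_zeroUnits_labelStar (j : toyIndex.LabelStar) (vQ : toyIndex.VQ) :
    scaleFamily (zeroUnits p) j.1 vQ = LinearEquiv.refl ℚ _ := by
  refine LinearEquiv.ext fun x => (line j.1 vQ).injective ?_
  rw [line_scaleFamily]
  show ((if j.1 = 0 then ppowUnit p 1 else 1 : ℚˣ) : ℚ) * line j.1 vQ x = line j.1 vQ x
  rw [if_neg j.2, Units.val_one, one_mul]

/-- … while at label `0` it carries `B_k` onto `B_{k+1}`. [folklore] -/
theorem image_pBall_scaleFamily_zeroUnits (vQ : toyIndex.VQ) (k : ℤ) :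
    scaleFamily (zeroUnits p) 0 vQ '' pBall p 0 vQ k = pBall p 0 vQ (k + 1) := by
  rw [image_pBall_scaleFamily]
  show pBall p 0 vQ (k + padicValRat p (((if (0 : toyIndex.Label) = 0 then ppowUnit p 1 else 1 : ℚˣ) : ℚ))) = _
  rw [if_pos rfl]
  show pBall p 0 vQ (k + padicValRat p ((p : ℚ) ^ (1 : ℤ))) = _
  rw [padicValRat_ppow]

/-- **The typed (hρ) FAILS at label 0 for every region operator that is BALL-VALUED there** (at some datum), over the Joshi-style shells and
for every setting: E-cx's `Joshi.not_thetaPinned_of_moves_zero` instantiated with the star-trivial (Ind2)-generator `scaleFamily (zeroUnits p)`.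
Hence no ball-valued zero-label convention can carry `PinnedRegions` here — the reason the landed model uses `univ` at label 0.
[claim: Mochizuki2012, status: disputed] -/
theorem not_thetaPinned_of_ball_zero (P : Setting (scalSituation p))
    (ρ : (∀ v : toyIndex.V, v ∈ toyIndex.Vbad → Set (scalShells.StarPacket v)) →
      ∀ (j : toyIndex.Label) (vQ : toyIndex.VQ), Set (scalShells.Packet j vQ))
    {Ψ : ∀ v : toyIndex.V, v ∈ toyIndex.Vbad → Set (scalShells.StarPacket v)} {vQ : toyIndex.VQ} {k : ℤ}
    (h0 : ρ Ψ 0 vQ = pBall p 0 vQ k) :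
    ¬ ThetaPinned (scalFull p).toLatticeSituation P ρ ∧ ∀ qK, ¬ PinnedRegions (scalFull p).toLatticeSituation P ρ qK :=
  not_thetaPinned_of_moves_zero (Φ := scaleFamily (zeroUnits p)) (Or.inr (scaleFamily_mem_Ind2Family _))
    (scaleFamily_zeroUnits_labelStar p) (by
    rw [h0, image_pBall_scaleFamily_zeroUnits]
    intro h
    have := pBall_injective p 0 vQ h
    omega)

/-- **In particular for the VERBATIM operator of the model of record** (`PinnedWitness.orbitRegion`: ρ₀ = 𝒪 = B_0 for every datum):
over the Joshi-style shells the typed Θ-pin and `PinnedRegions` FAIL for it at every setting — by the label-0 component alone (at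
the labels of `𝔽_l^⋆` its orbit form IS scaling-equivariant: part II `scalRegion_equivariant`, same formula). [claim: Mochizuki2012, status: disputed] -/
theorem not_pinnedRegions_orbitRegion (P : Setting (scalSituation p)) :
    ¬ ThetaPinned (scalFull p).toLatticeSituation P (orbitRegion p) ∧
      ∀ qK, ¬ PinnedRegions (scalFull p).toLatticeSituation P (orbitRegion p) qK :=
  not_thetaPinned_of_ball_zero p P (orbitRegion p) (Ψ := fun _ _ => ∅) (vQ := ()) (k := 0) (orbitRegion_zero p _ ())

/-- **The pins report, both readings, packaged**: (α) under the landed zero-label convention `univ` ALL pins hold for `scalRegion`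
(part II); (β) for the verbatim ball-valued operator `orbitRegion` the typed Θ-pin fails (label 0 only). [folklore] -/
theorem pins_report :
    PinnedRegions3 (scalFull p).toLatticeSituation (scalSetting p) (scalRegion p) (qDatum p) ∧
      ¬ ThetaPinned (scalFull p).toLatticeSituation (scalSetting p) (orbitRegion p) :=
  ⟨scalSetting_pinnedRegions3 p, (not_pinnedRegions_orbitRegion p (scalSetting p)).1⟩

end Summit.ABC.IUTFork.Joshi.IsmScaling

end
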